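import Summits.QuantumFields.YangMills.Theorems.BalabanUVNodesN05SubBP2CT8SrvGammaPrime
import Literature.MathematicalPhysics.QuantumFieldTheory.Balaban1983to89.B8LeafKnitZdGF3P2GammaPrime
import Literature.MathematicalPhysics.QuantumFieldTheory.Balaban1983to89.B8Prop3PrintedZdGF3P2Gamma
import Literature.MathematicalPhysics.QuantumFieldTheory.Balaban1983to89.B8SockSP5UniformThresholdsSrcGammaPrime
import Literature.MathematicalPhysics.QuantumFieldTheory.Balaban1983to89.B8Prop7TowerAxialRecordP
import Literature.MathematicalPhysics.QuantumFieldTheory.Balaban1983to89.B9SupplySockB9P3ZdGammaUnivDelta2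

/-!
# BalabanUVNodes ∕ N05 ([Balaban1985RegularSpaces] Lemma 1 p. 79 – Thm 8 p. 101): THE «P₂C» KNIT — the re-typed [B8] leaf `B8LeafKnitRSC.B8LeafRSC` (Proposition 7 in
# the repaired-constant currency `C₇ := 530·D·L²`, axial map PINNED to print's tower map `toAxialTowerResid`) over the COLLAR (admissible, (1.3)–(1.4)) sub-family of
# the four-law `Ω₀ = ℤᵈ` sub-index on the EDITION-δ₂ carrier `zdGF3HP₂` (Hölder member of (1.36) «on Ω_j»), knit on the γ′ socket family with [4]'s b9 sockets in
# print's BOTH-POINTS Hölder class — **PROPOSITION 7 SERVED** (dag-n05-w1 `prop7RepairedC_famB8OfRecordSubBP_toAxialTower_domainSeq`, p602967), Lemma 1,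
# Thm 2, Prop 3, Thm 4, Thm 8-surviving from tree theorems; Proposition 5 ∃∕! (at `lan`) and Proposition 6 (at `c₁`, all `CubeB8` cubes) DISPLAYED — D9b₂C, PIN-FREE:
# NODE 00's pin `Node00.CarriersB8SubBP2C.B8LeafOfRecordSubBP₂C θ (λ.cutSubB J lan c₁)` (dag-n05-w1) reads this conclusion by `Iff.rfl`

Track A of `YM-PLAN.md` (cell `pub-ymgap`, HUMAN RULING D-0062), node **N05**; seat `pub-ymgap-dag-n05-d` (g11), 2026-08-28; bears on K1⁷ `stmt-QuantumFields-20542`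
(`--supports … --as helper`, count-neutral).  THE STORY IN ONE PARAGRAPH.  D9b (p596490) knit NODE 00's P-slot `B8LeafOfRecordSubBP θ (λ.cutSubB J lan c₁)` from
[4]-type sockets, displaying `p5e p5u p6 p7`.  Three located narrownesses of that slot were then repaired by ONE re-pin «P₂C» (this seat's DESIGN, dag-n05-w1's
WORD «YES + index on the existing `B8ConstraintBonds.DomainSeq`», dag-n05-e's ACK, cell bus 2026-08-28 03:12–03:13Z): №4 the Hölder member of (1.36) and line 5 of
(1.59) are printed «on Ω_j» — edition δ₂ of the carrier (`B8LeafModelZd3P2`, p599986) and dag-n06-b's both-points socket `SockB9P3H2` (p598001); the (1.4) collar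
law is an INDEX law — the admissible sub-family `{j : IdxB8SubB θ ∕∕ DomainSeq θ.L j.1.1.Ω}` (dag-n05-w2 `B8Prop7TowerAxialAdmissible`, p601036); Proposition 7's
currency — the leaf shape `B8LeafRSC` with `p7 : Prop7RepairedC C₇` (this seat, p602607), because the tree's only Prop-7 supplier at nested `ℤᵈ` members gives
`530·D·L²` (dag-n05-w1 `B8Prop7TowerAxialCollarP` ∕ `…RecordP`, p598716 ∕ p600262) and `Prop7RepairedC C → Prop7PrintedR` needs `C ≤ 2`.  THIS FILE is D9b RE-RUN on
that sub-family, carrier and leaf shape (generator `gen_d9b2c.py` on D9b's tree bytes): the socket binders gain the antecedent `DomainSeq θ.L i.Ω` (N06 serves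
fewer members), `SB9P` is typed `SockB9P3H2`, the sourced Prop-3-frame socket's Hölder line is both-points, the callees are the δ₂ twins (this seat's
`prop3Printed_zdGF3P₂_map_γ` p600916, `t8P₂C_of_socketsSrc_γ'`, dag-n05-w2's `b8LeafRSC_zdGF3HP₂_mapJ_γ'` with Theorem 4 through the `Iff.rfl` transfer
`thm4Printed_zdGF3HP₂_iff`), the axial map is `toAxialTowerResid θ λ.β λ.len ∘ (·.1.1)`, and — the payoff — the `p7` binder is GONE: Proposition 7 is the tree
theorem `prop7RepairedC_famB8OfRecordSubBP_toAxialTower_domainSeq` (dag-n05-w1 p602967; collar law from `DomainSeq` by dag-n05-w2's `collar_of_domainSeq'`),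
moved to `zdGF3HP₂` by `prop7RepairedC_zdGF3HP₂_iff` (Proposition 7 does not read (1.36)).

WHAT IS PROVED (composition BY NAME; no estimate; no new definition):
* ★★★ **`b8LeafRSC_P2C_of_knit_lettersSrc_γ'`** — `B8LeafRSC θ.D θ.L λ.C₂ λ.B₁′ λ.inp.B₀′ λ.B₁ λ.B₂ c₁ λ.inp λ.B₀β (530·θ.D·θ.L²) (blockPairNA θ.D θ.L θ.𝔸)
  (fun j : {j : IdxB8SubB θ ∕∕ DomainSeq θ.L j.1.1.Ω} => zdGF3HP₂ θ.𝔸 θ.L λ.β λ.len j.1.1.1) lan (fun j : IdxB8SubB θ => cubB8OfRecord θ j.1) (toAxialTowerResid θ λ.β λ.len ∘ (·.1.1))`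
  from: [4]'s letters at the COLLAR law members (`SLet`, `SLetUB`), the sourceless b9 socket of Prop. 3's frame in print's both-points class (`SB9P : SockB9P3H2 …`,
  threshold `cB9`), Theorem 8's constants `c59 cP3 γ₈ γ′ γ″ γβ B₈ B₈β` with the four layer equations and the sourced free-constant guard, the two sourced b9 sockets
  (`SH59src`, `SB9srcHP` — Hölder line both-points) — all at collar law members ONLY —, Proposition 5 ∃∕! at `lan` (`p5e p5u`), Proposition 6 on the record's cube
  family at `c₁` (`p6`).  NO `p7` binder.
NET for N05 after «P₂C»: the printed members Lemma 1, Thm 2, Prop 3, Thm 4, **Prop 7**, Thm 8 are supplied by tree theorems in this knit; Prop 5 is served at print's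
`zdLan` family (D9c pattern) and Prop 6 at the print-class cut (D9d pattern) by the sibling twins; what stays DISPLAYED is N06 content only ([4]-type sockets ∕ letters at
the collar law members) + constants ∕ layer equations ∕ guards.
HONEST FRAMING: kernel bookkeeping by name; the sockets are HYPOTHESES ([Balaban1985BackgroundPropagators]-type statements; their satisfiability at `m ≥ 1` is the N06
lineage's OPEN content, NOT claimed); Proposition 7 enters in the REPAIRED-CONSTANT currency `C₇ = 530·D·L²` — WEAKER than print's `2α₂` (ref-A g26 WATCH-P7-CURRENCY-RECORD:
a statement-of-record change the planners display; consumers are threshold-existential in `α₂`, `B8Ineq145.thm2_after_prop7RepairedC`); count-neutral; **N05 NOT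
discharged**; Bałaban AS PRINTED with locators; constants sufficient, not optimal; one finite 𝕋⁴ programme at fixed ε; nothing continuum ∕ ℝ⁴ ∕ OS ∕ mass-gap ∕ Clay.
No `sorry`, no new definition.  Unit `pub-ymgap-dag-n05-d` (g11), 2026-08-28.
[cite: Balaban1985RegularSpaces, Lemma 1 p.79, Thm 2 p.83, Prop. 3 p.87 + (1.61), Thm 4 p.88, Prop. 5 (1.106)–(1.110) p.94, Prop. 6 (1.131)–(1.138) p.99, Prop. 7 (1.143)–(1.145) p.100, Thm 8 (1.146) p.101, (1.3)–(1.4) p.77, (1.31) p.82, (1.35)–(1.36) p.82; Balaban1985BackgroundPropagators, Thm 3.1 p.397, Thm 3.3 p.398, (3.40) p.397]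
-/

noncomputable section

namespace Summit.QuantumFields.YangMills.BalabanUVNodes.N05SubBP2CKnitGammaPrime

open Literature.MathematicalPhysics.QuantumFieldTheory.Balaban1983to89
open Literature.MathematicalPhysics.QuantumFieldTheory.Balaban1983to89.Node00
open Literature.MathematicalPhysics.QuantumFieldTheory.Balaban1983to89.B8IdxB8LawsB (IdxB8LawsB IdxB8SubB)
open Literature.MathematicalPhysics.QuantumFieldTheory.Balaban1983to89.B8LeafModelZd (ZdIdx)
open Literature.MathematicalPhysics.QuantumFieldTheory.Balaban1983to89.B8LeafModelZd3 (SockB9P3)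
open Literature.MathematicalPhysics.QuantumFieldTheory.Balaban1983to89.B9SupplySockB9P3ZdGammaUnivDelta2 (SockB9P3H2)
open Literature.MathematicalPhysics.QuantumFieldTheory.Balaban1983to89.B8LeafModelZd3P (zdGF3P zdGF3HP)
open Literature.MathematicalPhysics.QuantumFieldTheory.Balaban1983to89.B8LeafModelZd3P2 (zdGF3P₂ zdGF3HP₂ prop7RepairedC_zdGF3HP₂_iff)
open Literature.MathematicalPhysics.QuantumFieldTheory.Balaban1983to89.B8LeafKnitRSC (B8LeafRSC)
open Literature.MathematicalPhysics.QuantumFieldTheory.Balaban1983to89.B8Prop7TowerAxialRecord (toAxialTowerResid)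
open Literature.MathematicalPhysics.QuantumFieldTheory.Balaban1983to89.B8Prop7TowerAxialRecordP (prop7RepairedC_famB8OfRecordSubBP_toAxialTower_domainSeq)
open Literature.MathematicalPhysics.QuantumFieldTheory.Balaban1983to89.B8TowerBondsPrinted (towerBondsP)
open Literature.MathematicalPhysics.QuantumFieldTheory.Balaban1983to89.B8SockLettersRD (SockLettersRD)
open Literature.MathematicalPhysics.QuantumFieldTheory.Balaban1983to89.B8Lemma1NonAbelian (mulCfg blockPairNA)
open Literature.MathematicalPhysics.QuantumFieldTheory.Balaban1983to89.B8LeafKnitZdGF3P2GammaPrime (b8LeafRSC_zdGF3HP₂_mapJ_γ')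
open Literature.MathematicalPhysics.QuantumFieldTheory.Balaban1983to89.B8Prop3PrintedZdGF3P2Gamma (prop3Printed_zdGF3P₂_map_γ)
open Literature.MathematicalPhysics.QuantumFieldTheory.Balaban1983to89.B8SockSP5UniformThresholdsSrcGammaPrime (exists_uniform_threshold_sp5_src_γ' exists_uniform_threshold_sp5base_src_γ' exists_uniform_threshold_sp5u_src_γ')
open Literature.MathematicalPhysics.QuantumFieldTheory.Balaban1983to89.B8LanF146 (LanF146 lanF146_zero_iff)
open Literature.MathematicalPhysics.QuantumFieldTheory.Balaban1983to89.B8Eq138LandauZd (covLap QT InR138 IsLandau146W inR138_zero)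
open Summit.QuantumFields.YangMills.BalabanUVNodes.N05SubBP2CT8SrvGammaPrime (t8P₂C_of_socketsSrc_γ')
open MatrixLog B7Prop1Explicit B7Prop2Explicit B7Prop1Local B7Eq92Concrete
open B8Ineq130 (tlo thi)
open B8Ineq132 (InAk covDerivFwd)
open B7Eq78Linearization (zdBlocking QprimeIter)
open B8Eq119TwistedAxial (bgT Restr129 InAx)
open B8Eq140Level (SideTouches)
open B8Eq1117Concrete (XSpace)
open B8Prop5ContractionKLevel (Bd2)
open B8LambdaSpaceKLevel (wt)
open B8Eq184Proof (gaugeExp cfgExp)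
open B8Eq146AExpansion (iEta plaqCovDeriv)
open B8Eq143PlaqExpansion (pdiv)
open B7Prop4GeneralLevels (linCovIter)
open B8Eq155JBound (Jcur wsup)
open B8ScaledSupNorm (bondNorm msup Bdd msup_le bdd_of_forall)
open B9Eq340HolderZd (hquot AdmPair)

-- `Site` alone could resolve to the torus sites of `Setup.lean`; re-export the `ℤ^d` sites of `B7Prop1Explicit`.
export B7Prop1Explicit (Site)

section KnitP2C

/-- ★★★ **THE «P₂C» KNIT — `B8LeafRSC` ON THE COLLAR SUB-FAMILY OF THE EDITION-δ₂ CARRIER, PROPOSITION 7 SERVED** — for the record's `θ` (`D ≥ 2`), residual layer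
`λ`, any Proposition-5 family `lan : J → B8.LandauData` and Prop.-6 threshold `c₁`: from [4]'s letters (`SLet`, `SLetUB`) and the sourceless b9 socket of Prop. 3's
frame in print's both-points Hölder class (`SB9P : SockB9P3H2 …`, `cB9`) at the COLLAR law members (`i.Ω 0 = univ ∧ IdxB8LawsB θ.L i ∧ DomainSeq θ.L i.Ω`), Theorem 8's
constants with the four layer equations and the sourced free-constant guard, the two SOURCED b9 sockets `SH59src` (`c59`) ∕ `SB9srcHP` (`cP3`, Hölder line both-points) at
the collar law members, and the displayed `p5e p5u p6`: the leaf `B8LeafRSC … (530·θ.D·θ.L²) … (zdGF3HP₂ ∘ ·.1.1.1) lan (cubB8OfRecord ∘ ·.1) (toAxialTowerResid ∘ ·.1.1)`.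
PROOF (D9b's, token for token, plus ONE served conjunct): `p7 :=` dag-n05-w1's `prop7RepairedC_famB8OfRecordSubBP_toAxialTower_domainSeq λ.β λ.len hD` (p602967)
through `prop7RepairedC_zdGF3HP₂_iff`; `SP5base`∕`SP5`∕`SP5u` (γ′) below ONE member-uniform threshold from dag-n05-w4's `exists_uniform_threshold_sp5{base,,u}_src_γ'`;
`hP3 := prop3Printed_zdGF3P₂_map_γ` at `ι := (·.1.1.1)`; `t8 := t8P₂C_of_socketsSrc_γ'`; the leaf by dag-n05-w2's `b8LeafRSC_zdGF3HP₂_mapJ_γ'` at `ι := (·.1.1.1)`,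
`Φ := Site → 𝔸`, `Adm :=` Theorem 8's source premiss ρ2, `LanF := LanF146`, zero source `φ₀ := 0`.
[cite: Balaban1985RegularSpaces, Lemma 1 p.79, Thm 2 p.83, Prop. 3 p.87, Thm 4 p.88, Prop. 5 p.94, Prop. 6 p.99, Prop. 7 (1.144)–(1.145) p.100, Thm 8 (1.146) p.101, (1.3)–(1.4) p.77; Balaban1985BackgroundPropagators, Thm 3.1 p.397, Thm 3.3 p.398] -/
theorem b8LeafRSC_P2C_of_knit_lettersSrc_γ' {θ : Stage3Params} (lam : ResidB8 θ) (hD : 2 ≤ θ.D)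
    {cB9 B₀'H B₂' BG BR cL : ℝ}
    (hC₂eq : lam.C₂ = 2097152 * ((θ.D : ℝ) + 1) ^ 2 * (θ.L : ℝ) ^ 2)
    (hcB9 : 0 < cB9) (hB₀'H : 0 < B₀'H) (hB₂' : 0 ≤ B₂') (hBG : 0 ≤ BG) (hBR : 0 ≤ BR) (hcL : 0 < cL)
    -- [4]'s letters AT THE `Ω₀ = ℤᵈ` LAW MEMBERS ONLY: existence side (laws on print's domains) and uniqueness side
    (SLet : ∀ i : ZdIdx θ.D θ.L, i.Ω 0 = Set.univ → IdxB8LawsB θ.L i → B8ConstraintBonds.DomainSeq θ.L i.Ω → SockLettersRD (𝔸 := θ.𝔸) θ.L BG BR B₀'H B₂' cL i.η i.k i.Ω i.Λs)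
    (SLetUB : ∀ i : ZdIdx θ.D θ.L, i.Ω 0 = Set.univ → IdxB8LawsB θ.L i → B8ConstraintBonds.DomainSeq θ.L i.Ω → ∀ α₀ : ℝ, 0 < α₀ → α₀ ≤ cL → ∀ U₀ : Site θ.D → Fin θ.D → θ.𝔸ˣ, (∀ x κ, U₀ x κ ∈ unitaryUnits θ.𝔸) →
      InAk θ.L i.k i.η α₀ i.Ω U₀ →
      ∃ (g Δ : (Site θ.D → θ.𝔸) →ₗ[ℂ] (Site θ.D → θ.𝔸)) (q : (Site θ.D → θ.𝔸) →ₗ[ℂ] (ℕ → Site θ.D → θ.𝔸))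
        (qs : (ℕ → Site θ.D → θ.𝔸) →ₗ[ℂ] (Site θ.D → θ.𝔸)) (Aw c : (ℕ → Site θ.D → θ.𝔸) →ₗ[ℂ] (ℕ → Site θ.D → θ.𝔸))
        (H' : XSpace θ.D i.k θ.𝔸 →ₗ[ℂ] (Site θ.D → θ.𝔸)),
        (∀ x : Site θ.D → θ.𝔸, (∃ C : ℝ, ∀ y, ‖x y‖ ≤ C) → g (Δ x + qs (Aw (q x))) = x) ∧ (∀ φ, qs (c (q (g (g (qs φ))))) = qs φ) ∧
        (∀ (f : Site θ.D → θ.𝔸), ∀ x ∈ i.Ω 0, Δ f x = covLap i.η U₀ ((i.Ω 0).indicator f) x) ∧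
        (∀ (μ : ℕ → Site θ.D → θ.𝔸), ∀ x ∈ i.Ω 0, qs μ x = QT θ.L i.k (i.Λs i.k) U₀ μ x) ∧
        (∀ (f : Site θ.D → θ.𝔸) (n : ℕ), n ≤ i.k → ∀ y ∈ i.Λs i.k n, q f n y = QprimeIter (zdBlocking θ.D θ.L) (bgT θ.L U₀) n f y) ∧
        (∀ (f : Site θ.D → θ.𝔸) (n : ℕ) (y : Site θ.D), ¬ (n ≤ i.k ∧ y ∈ i.Λs i.k n) → q f n y = 0) ∧
        (∀ (X : XSpace θ.D i.k θ.𝔸) (x : Site θ.D), ‖H' X x‖ ≤ B₀'H * ‖X‖) ∧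
        (∀ n, n ≤ i.k → ∀ (X : XSpace θ.D i.k θ.𝔸), ∀ p ∈ {b : Site θ.D × Fin θ.D | SideTouches (i.Ω n) b.1 b.2},
          wt θ.L i.η n * ‖covDerivFwd i.η U₀ p.2 (H' X) p.1‖ ≤ B₀'H * ‖X‖) ∧
        (∀ X : XSpace θ.D i.k θ.𝔸, Bd2 θ.L i.η i.k i.Ω (covLap i.η U₀ (H' X)) (B₂' * ‖X‖)) ∧
        (∀ (Y : XSpace θ.D i.k θ.𝔸) (n : ℕ) (hn : n ≤ i.k) (y : Site θ.D), y ∈ i.Λs i.k n →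
          QprimeIter (zdBlocking θ.D θ.L) (bgT θ.L U₀) n (H' Y) y = Y (⟨n, Nat.lt_succ_of_le hn⟩, y)) ∧
        (∀ (f : Site θ.D → θ.𝔸) (r : ℝ), 0 ≤ r → Bd2 θ.L i.η i.k i.Ω f r →
          (∀ x, ‖g f x‖ ≤ BG * r) ∧ ∀ n, n ≤ i.k → ∀ p ∈ {b : Site θ.D × Fin θ.D | SideTouches (i.Ω n) b.1 b.2},
            wt θ.L i.η n * ‖covDerivFwd i.η U₀ p.2 (g f) p.1‖ ≤ BG * r) ∧
        (∀ (f : Site θ.D → θ.𝔸) (r : ℝ), 0 ≤ r → Bd2 θ.L i.η i.k i.Ω f r → Bd2 θ.L i.η i.k i.Ω (f - g (qs (c (q (g f))))) (BR * r)))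
    -- the SOURCELESS b9 socket of Proposition 3's frame over PRINT's class, at the law members only ([4] Thm 3.3; threshold `cB9`) — for Prop. 3 AS PRINTED
    (SB9P : ∀ i : ZdIdx θ.D θ.L, i.Ω 0 = Set.univ → IdxB8LawsB θ.L i → B8ConstraintBonds.DomainSeq θ.L i.Ω →
      SockB9P3H2 (𝔸 := θ.𝔸) θ.L lam.inp.B₀ lam.B₀β cB9 lam.β lam.len i.η i.k i.Ω i.Λs (fun m j => towerBondsP θ.L i.Ω (i.Λs m) j))
    -- PROPOSITION 5 at an arbitrary family `lan`, PROPOSITION 6 on the record's cube family at `c₁` — DISPLAYED (Proposition 7 is SERVED below)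
    {J : Type} {lan : J → B8.LandauData}
    (p5e : B8.Prop5Exists lam.inp.B₀' lam.B₁ lan) (p5u : B8.Prop5Unique lan)
    (c₁ : ℝ) (p6 : B8.Prop6Printed θ.D (θ.L : ℝ) lam.B₁ c₁ (fun j : IdxB8SubB θ => cubB8OfRecord θ j.1))
    -- THEOREM 8's CONSTANTS, the layer equations, the sourced free-constant guard, the two SOURCED b9 sockets at the law members
    {c59 cP3 γ₈ γ' γ'' γβ B₈ B₈β : ℝ} (hc59 : 0 < c59) (hcP3 : 0 < cP3) (hγ₈ : 1 ≤ γ₈) (hγ' : 0 ≤ γ') (hγ'' : 0 ≤ γ'')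
    (hB : 2 ≤ 5 * (θ.D : ℝ) * θ.L * lam.inp.B₀) (hB₀β : 0 < lam.B₀β) (hB₀8 : lam.inp.B₀ ≤ B₈)
    (hγB : 5 * (θ.D : ℝ) * θ.L * lam.inp.B₀ + 2 * (γ' * lam.inp.B₀) ≤ 5 * (θ.D : ℝ) * θ.L * B₈)
    (hγB'' : 5 * (θ.D : ℝ) * θ.L * lam.inp.B₀ + 2 * (γ'' * lam.inp.B₀) ≤ 5 * (θ.D : ℝ) * θ.L * B₈)
    (hB8β : 5 * (θ.D : ℝ) * θ.L * lam.B₀β + 2 * lam.B₀β * (γ'' * lam.inp.B₀) + γβ ≤ 5 * (θ.D : ℝ) * θ.L * B₈β)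
    (hB₁' : lam.B₁' = 5 * (θ.D : ℝ) * θ.L * B₈)
    (hB₁eq : lam.B₁ = 5 * (θ.D : ℝ) * θ.L * B₈ * (1 + 11 * (θ.D : ℝ) ^ 2)) (hB₂eq : lam.B₂ = 5 * (θ.D : ℝ) * θ.L * B₈β * (1 + 11 * (θ.D : ℝ) ^ 2))
    (hfreeS : 3 * (2 * (θ.D : ℝ) * (θ.L : ℝ) ^ 2) * BG * BR * (B₈ + γ₈) ≤ lam.inp.B₀' * B₈)
    -- [Balaban1985BackgroundPropagators] Thm 3.3 WITH SOURCE in Theorem 4's frame at (1.146), γ′ letter, threshold `c59`, at the law members ONLY — HYPOTHESIS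
    (SH59src : ∀ i : ZdIdx θ.D θ.L, i.Ω 0 = Set.univ → IdxB8LawsB θ.L i → B8ConstraintBonds.DomainSeq θ.L i.Ω → ∀ α₀ α₁ : ℝ, 0 < α₀ → 0 < α₁ → α₀ + α₁ ≤ c59 →
      ∀ U₀ U' : Site θ.D → Fin θ.D → θ.𝔸ˣ, (∀ x κ, U₀ x κ ∈ unitaryUnits θ.𝔸) → (∀ x κ, U' x κ ∈ unitaryUnits θ.𝔸) →
      ∀ φ : Site θ.D → θ.𝔸, ((InR138 θ.L i.k i.η (i.Ω 0) (i.Λs i.k) U₀ φ ∧ (∀ x, IsSelfAdjoint (φ x)) ∧ (∀ x, x ∉ i.Ω 0 → φ x = 0) ∧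
          Bdd θ.L i.k i.η (-(2 : ℝ)) (fun j (x : Site θ.D) => x ∈ i.Ω j) φ) ∧
        msup θ.L i.k i.η (-(2 : ℝ)) (fun j (x : Site θ.D) => x ∈ i.Ω j) φ < γ₈ * (α₀ + α₁)) →
      InAk θ.L i.k i.η α₀ i.Ω U₀ → InAk θ.L i.k i.η α₀ i.Ω (mulCfg U' U₀) → (∀ m, m ≤ i.k → InAx θ.L m (i.Λs m) U₀ (mulCfg U' U₀)) →
      (∀ j, j ≤ i.k → ∀ (z : Site θ.D) (μ : Fin θ.D),
        ((∀ x, InBox (tlo θ.L z j) (thi θ.L z j) x → x ∈ i.Ω j) ∨ (∀ x, InBox (tlo θ.L (z + e μ) j) (thi θ.L (z + e μ) j) x → x ∈ i.Ω j)) →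
        ‖(avgIter θ.L (mulCfg U' U₀) j z μ : θ.𝔸) - (avgIter θ.L U₀ j z μ : θ.𝔸)‖ ≤ α₁) →
      (∀ b ∈ {b : Site θ.D × Fin θ.D | SideTouches (i.Ω 0) b.1 b.2}, ‖((U' b.1 b.2 : θ.𝔸ˣ) : θ.𝔸) - 1‖ ≤ α₁) →
      (∀ m, 1 ≤ m → m ≤ i.k → ∀ (u : Site θ.D → θ.𝔸ˣ) (W : Site θ.D → Fin θ.D → θ.𝔸ˣ) (A' : Site θ.D → Fin θ.D → θ.𝔸),
        (∀ x, u x ∈ unitaryUnits θ.𝔸) → mgauge U₀ u W = U' → Restr129 θ.L m (i.Λs m) U₀ u → LanF146 θ.L i.k i.η (i.Ω 0) i.Λs U₀ φ m W →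
        (∀ y τ, IsSelfAdjoint (A' y τ)) →
        (∀ j, j ≤ m → ∀ y τ, SideTouches (i.Ω j) y τ →
        W y τ = cfgExp i.η A' y τ ∧ ‖A' y τ‖ ≤ (2 * (θ.L * (5 * (θ.D : ℝ) * θ.L * B₈ * (α₀ + α₁))) + 8 * (8 * lam.inp.B₀' * (5 * (θ.D : ℝ) * θ.L * B₈) * (α₀ + α₁))) * ((θ.L : ℝ) ^ j * i.η)⁻¹) →
        (∀ y τ, (∀ j, j ≤ m → ¬ SideTouches (i.Ω j) y τ) → A' y τ = 0) →
        msup θ.L m i.η (-(1 : ℝ)) (fun j (b : Site θ.D × Fin θ.D) => SideTouches (i.Ω j) b.1 b.2) (fun b => A' b.1 b.2)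
        ≤ lam.inp.B₀ * (bondNorm θ.L m i.η (-(3 : ℝ)) i.Ω (fun x μ => Jcur i.η U₀ A' μ x)
        + wsup 1 (fun p : {p : ℕ × (Site θ.D × Fin θ.D) // p.1 ≤ m ∧ p.2 ∈ towerBondsP θ.L i.Ω (i.Λs m) p.1} =>
        linCovIter θ.L U₀ (iEta i.η A') p.1.1 p.1.2.1 p.1.2.2)) + γ' * lam.inp.B₀ * (α₀ + α₁) ∧
        msup θ.L m i.η (-(2 : ℝ)) (fun j (t : Fin θ.D × Fin θ.D × Site θ.D) => SideTouches (i.Ω j) t.2.2 t.2.1)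
        (fun t => covDerivFwd i.η U₀ t.1 (fun z => A' z t.2.1) t.2.2)
        ≤ lam.inp.B₀ * (bondNorm θ.L m i.η (-(3 : ℝ)) i.Ω (fun x μ => Jcur i.η U₀ A' μ x)
        + wsup 1 (fun p : {p : ℕ × (Site θ.D × Fin θ.D) // p.1 ≤ m ∧ p.2 ∈ towerBondsP θ.L i.Ω (i.Λs m) p.1} =>
        linCovIter θ.L U₀ (iEta i.η A') p.1.1 p.1.2.1 p.1.2.2)) + γ' * lam.inp.B₀ * (α₀ + α₁)))
    -- THE SOURCED b9 SOCKET OF PROPOSITION 3's FRAME at the `Ω₀ = ℤᵈ` law members, threshold `cP3`, `|B₁|` over print's class at the top truncation — HYPOTHESIS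
    -- ([Balaban1985BackgroundPropagators] Thm 3.3 with source; = `B8Prop3SrcZd3HPGamma`'s input letter for letter)
    (SB9srcHP : ∀ i : ZdIdx θ.D θ.L, i.Ω 0 = Set.univ → IdxB8LawsB θ.L i → B8ConstraintBonds.DomainSeq θ.L i.Ω → ∀ α₀ α₁ α₂ : ℝ, 0 < α₀ → α₀ ≤ cP3 → 0 < α₁ → 0 < α₂ → α₂ ≤ cP3 →
      ∀ (U₀ W : Site θ.D → Fin θ.D → θ.𝔸ˣ), (∀ x κ, U₀ x κ ∈ unitaryUnits θ.𝔸) → (∀ x κ, W x κ ∈ unitaryUnits θ.𝔸) →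
      ∀ f : Site θ.D → θ.𝔸, InR138 θ.L i.k i.η (i.Ω 0) (i.Λs i.k) U₀ f →
      (∀ x, IsSelfAdjoint (f x)) → (∀ x, x ∉ i.Ω 0 → f x = 0) →
      Bdd θ.L i.k i.η (-(2 : ℝ)) (fun j (x : Site θ.D) => x ∈ i.Ω j) f →
      msup θ.L i.k i.η (-(2 : ℝ)) (fun j (x : Site θ.D) => x ∈ i.Ω j) f < γ₈ * (α₀ + α₁) →
      msup θ.L i.k i.η (-(3 : ℝ)) (fun j (p : Fin θ.D × Site θ.D) => p.2 ∈ i.Ω j) (fun p => covDerivFwd i.η U₀ p.1 f p.2) < γ₈ * (α₀ + α₁) →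
      InAk θ.L i.k i.η α₀ i.Ω U₀ → InAk θ.L i.k i.η α₀ i.Ω (mulCfg W U₀) → IsLandau146W θ.L i.k i.η (i.Ω 0) (i.Λs i.k) U₀ f W →
      ∀ A' : Site θ.D → Fin θ.D → θ.𝔸, (∀ y τ, IsSelfAdjoint (A' y τ)) →
      (∀ j, j ≤ i.k → ∀ (y : Site θ.D) (τ : Fin θ.D), SideTouches (i.Ω j) y τ →
        W y τ = cfgExp i.η A' y τ ∧ ‖A' y τ‖ ≤ α₂ * ((θ.L : ℝ) ^ j * i.η)⁻¹) →
      (∀ (y : Site θ.D) (τ : Fin θ.D), (∀ j, j ≤ i.k → ¬ SideTouches (i.Ω j) y τ) → A' y τ = 0) →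
      msup θ.L i.k i.η (-(1 : ℝ)) (fun j (b : Site θ.D × Fin θ.D) => SideTouches (i.Ω j) b.1 b.2) (fun b => A' b.1 b.2)
          ≤ lam.inp.B₀ * (bondNorm θ.L i.k i.η (-(3 : ℝ)) i.Ω (fun x μ => Jcur i.η U₀ A' μ x)
            + wsup 1 (fun p : {p : ℕ × (Site θ.D × Fin θ.D) // p.1 ≤ i.k ∧ p.2 ∈ towerBondsP θ.L i.Ω (i.Λs i.k) p.1} =>
                linCovIter θ.L U₀ (iEta i.η A') p.1.1 p.1.2.1 p.1.2.2)) + γ'' * lam.inp.B₀ * (α₀ + α₁) ∧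
        msup θ.L i.k i.η (-(2 : ℝ)) (fun j (t : Fin θ.D × Fin θ.D × Site θ.D) => SideTouches (i.Ω j) t.2.2 t.2.1)
            (fun t => covDerivFwd i.η U₀ t.1 (fun z => A' z t.2.1) t.2.2)
          ≤ lam.inp.B₀ * (bondNorm θ.L i.k i.η (-(3 : ℝ)) i.Ω (fun x μ => Jcur i.η U₀ A' μ x)
            + wsup 1 (fun p : {p : ℕ × (Site θ.D × Fin θ.D) // p.1 ≤ i.k ∧ p.2 ∈ towerBondsP θ.L i.Ω (i.Λs i.k) p.1} =>
                linCovIter θ.L U₀ (iEta i.η A') p.1.1 p.1.2.1 p.1.2.2)) + γ'' * lam.inp.B₀ * (α₀ + α₁) ∧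
        bondNorm θ.L i.k i.η (-(3 : ℝ)) i.Ω (fun x μ => pdiv i.η U₀ (plaqCovDeriv i.η U₀ A') μ x)
          ≤ lam.inp.B₀ * (bondNorm θ.L i.k i.η (-(3 : ℝ)) i.Ω (fun x μ => Jcur i.η U₀ A' μ x)
            + wsup 1 (fun p : {p : ℕ × (Site θ.D × Fin θ.D) // p.1 ≤ i.k ∧ p.2 ∈ towerBondsP θ.L i.Ω (i.Λs i.k) p.1} =>
                linCovIter θ.L U₀ (iEta i.η A') p.1.1 p.1.2.1 p.1.2.2)) + γ'' * lam.inp.B₀ * (α₀ + α₁) ∧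
        bondNorm θ.L i.k i.η (-(3 : ℝ)) i.Ω (fun x μ => covLap i.η U₀ (fun z => A' z μ) x)
          ≤ lam.inp.B₀ * (bondNorm θ.L i.k i.η (-(3 : ℝ)) i.Ω (fun x μ => Jcur i.η U₀ A' μ x)
            + wsup 1 (fun p : {p : ℕ × (Site θ.D × Fin θ.D) // p.1 ≤ i.k ∧ p.2 ∈ towerBondsP θ.L i.Ω (i.Λs i.k) p.1} =>
                linCovIter θ.L U₀ (iEta i.η A') p.1.1 p.1.2.1 p.1.2.2)) + γ'' * lam.inp.B₀ * (α₀ + α₁) ∧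
        msup θ.L i.k i.η (-(2 + lam.β)) (fun j (q : Fin θ.D × Fin θ.D × (Site θ.D × Site θ.D)) => q.2.2 ∈ AdmPair i.η lam.len ∧ q.2.2.1 ∈ i.Ω j ∧ q.2.2.2 ∈ i.Ω j)
            (fun q => hquot i.η lam.β lam.len U₀ (covDerivFwd i.η U₀ q.1 (fun z => A' z q.2.1)) q.2.2)
          ≤ lam.B₀β * (bondNorm θ.L i.k i.η (-(3 : ℝ)) i.Ω (fun x μ => Jcur i.η U₀ A' μ x)
            + wsup 1 (fun p : {p : ℕ × (Site θ.D × Fin θ.D) // p.1 ≤ i.k ∧ p.2 ∈ towerBondsP θ.L i.Ω (i.Λs i.k) p.1} =>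
                linCovIter θ.L U₀ (iEta i.η A') p.1.1 p.1.2.1 p.1.2.2)) + γβ * (α₀ + α₁)) :
    B8LeafRSC θ.D (θ.L : ℝ) lam.C₂ lam.B₁' lam.inp.B₀' lam.B₁ lam.B₂ c₁ lam.inp lam.B₀β (530 * (θ.D : ℝ) * (θ.L : ℝ) ^ 2) (blockPairNA θ.D θ.L θ.𝔸)
      (fun j : {j : IdxB8SubB θ // B8ConstraintBonds.DomainSeq θ.L j.1.1.Ω} => zdGF3HP₂ θ.𝔸 θ.L lam.β lam.len j.1.1.1) lan
      (fun j : IdxB8SubB θ => cubB8OfRecord θ j.1) (fun j => toAxialTowerResid θ lam.β lam.len j.1.1) := by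
  -- PROPOSITION 7 SERVED (repaired constant 530·D·L², print's tower-wise axial map) on the DomainSeq (collar) sub-family: dag-n05-w1's record face at `e := (·.1)`
  -- (v1.1 `_domainSeq`, collar law from `DomainSeq` by dag-n05-w2's `collar_of_domainSeq'`), transferred from `zdGF3HP` to the edition-δ₂ carrier (Proposition 7 does not read (1.36))
  have p7 : B8Ineq145.Prop7RepairedC (530 * (θ.D : ℝ) * (θ.L : ℝ) ^ 2) (fun j : {j : IdxB8SubB θ // B8ConstraintBonds.DomainSeq θ.L j.1.1.Ω} => zdGF3HP₂ θ.𝔸 θ.L lam.β lam.len j.1.1.1)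
      (fun j => toAxialTowerResid θ lam.β lam.len j.1.1) :=
    (prop7RepairedC_zdGF3HP₂_iff (𝔸 := θ.𝔸) (fun j : {j : IdxB8SubB θ // B8ConstraintBonds.DomainSeq θ.L j.1.1.Ω} => j.1.1.1) _ _).2
      (prop7RepairedC_famB8OfRecordSubBP_toAxialTower_domainSeq lam.β lam.len hD)
  -- constants: `0 < B₀ ≤ B₈`, `2 ≤ 5dLB₀ ≤ 5dLB₈`, `0 ≤ γ₈`, `2γ′B₀ ≤ 5dLB₈`
  have hB₀ : 0 < lam.inp.B₀ := lam.inp.B₀_pos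
  have hB₈ : 0 < B₈ := lt_of_lt_of_le hB₀ hB₀8
  have h5 : 0 ≤ 5 * (θ.D : ℝ) * θ.L := by positivity
  have hB8' : 2 ≤ 5 * (θ.D : ℝ) * θ.L * B₈ := hB.trans (mul_le_mul_of_nonneg_left hB₀8 h5)
  have hγ₈0 : 0 ≤ γ₈ := zero_le_one.trans hγ₈
  have hγ₈pos : 0 < γ₈ := lt_of_lt_of_le one_pos hγ₈
  have hγB2 : 2 * (γ' * lam.inp.B₀) ≤ 5 * (θ.D : ℝ) * θ.L * B₈ :=
    le_trans (le_add_of_nonneg_left (mul_nonneg h5 hB₀.le)) hγB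
  -- PROPOSITION 5 ∃∕! WITH SOURCE in the γ′ letters: the three sourced sockets below member-UNIFORM thresholds (dag-n05-w4)
  obtain ⟨cP5, hcP5, H5⟩ := exists_uniform_threshold_sp5_src_γ' (𝔸 := θ.𝔸) (γ := γ₈) hD θ.two_le_L hB8' hfreeS hcL hB₀ lam.inp.B₀'_pos hB₀'H hB₂' hBG
    hBR hγ₈0 hγ' hB₀8 hγB2 hc59
  obtain ⟨cPb, hcPb, Hb⟩ := exists_uniform_threshold_sp5base_src_γ' (𝔸 := θ.𝔸) (γ := γ₈) hD θ.two_le_L hfreeS hcL lam.inp.B₀'_pos hB₀'H hB₂' hBG hBR hγ₈0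
    hB₈ hB8'
  obtain ⟨cu, cPu, hcu, hcPu, Hu⟩ := exists_uniform_threshold_sp5u_src_γ' (𝔸 := θ.𝔸) (γ := γ₈) hD θ.two_le_L hB8' hcL hB₀ lam.inp.B₀'_pos hB₀'H hB₂' hBG hBR
    hγ₈0 hγ' hB₀8 hγB2 hc59
  -- ONE threshold for the four Prop-5-type sockets
  have hcP : 0 < min c59 (min cPb (min cP5 cPu)) := lt_min hc59 (lt_min hcPb (lt_min hcP5 hcPu))
  have hP59 : min c59 (min cPb (min cP5 cPu)) ≤ c59 := min_le_left _ _
  have hPb : min c59 (min cPb (min cP5 cPu)) ≤ cPb := (min_le_right _ _).trans (min_le_left _ _)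
  have hP5 : min c59 (min cPb (min cP5 cPu)) ≤ cP5 := (min_le_right _ _).trans ((min_le_right _ _).trans (min_le_left _ _))
  have hPu : min c59 (min cPb (min cP5 cPu)) ≤ cPu := (min_le_right _ _).trans ((min_le_right _ _).trans (min_le_right _ _))
  -- PROPOSITION 3 AS PRINTED on the P-carrier at the law members (this seat's D3, index-map form)
  have hP3 := prop3Printed_zdGF3P₂_map_γ (𝔸 := θ.𝔸) hD θ.two_le_L lam.inp hB₀β.le (le_of_eq hC₂eq.symm) hcB9 lam.β lam.len
    (fun j : {j : IdxB8SubB θ // B8ConstraintBonds.DomainSeq θ.L j.1.1.Ω} => j.1.1.1) (fun j => SB9P j.1.1.1 j.1.1.2 j.1.2 j.2)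
  -- THEOREM 8 SURVIVING at the P-members (this seat's D9a, sockets served as above)
  have t8 := t8P₂C_of_socketsSrc_γ' lam hD hcP hcu hcP3 hγ₈ hγ' hγ'' hB hB₀β hB₀8 hγB hγB'' hB8β hB₁eq hB₂eq
    (fun i hΩ hl hds α₀ α₁ hα₀ hα₁ hs => Hb i.η i.k i.Ω i.Λs (fun m j => towerBondsP θ.L i.Ω (i.Λs m) j) i.hη i.hk i.hΩ
      hl.toIdxB8Laws.tower_all (SLet i hΩ hl hds) α₀ α₁ hα₀ hα₁ (hs.trans hPb))
    (fun i hΩ hl hds α₀ α₁ hα₀ hα₁ hs => H5 i.η i.k i.Ω i.Λs (fun m j => towerBondsP θ.L i.Ω (i.Λs m) j) i.hη i.hΩ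
      (B8TowerBondsPrinted.ZdIdx.towerBondsP_laws i).1 (B8TowerBondsPrinted.ZdIdx.towerBondsP_laws i).2 hl.toIdxB8Laws.tower_all
      hl.trunc_lt hl.trunc_top (SLet i hΩ hl hds) (SH59src i hΩ hl hds) α₀ α₁ hα₀ hα₁ (hs.trans hP5))
    (fun i hΩ hl hds α₀ α₁ hα₀ hα₁ hs => SH59src i hΩ hl hds α₀ α₁ hα₀ hα₁ (hs.trans hP59))
    (fun i hΩ hl hds α₀ α₁ hα₀ hα₁ hs => Hu i.η i.k i.Ω i.Λs (fun m j => towerBondsP θ.L i.Ω (i.Λs m) j) i.hη i.hk i.hΩ hΩ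
      (B8TowerBondsPrinted.ZdIdx.towerBondsP_laws i).1 (B8TowerBondsPrinted.ZdIdx.towerBondsP_laws i).2 i.htower
      (SLetUB i hΩ hl hds) (SH59src i hΩ hl hds) α₀ α₁ hα₀ hα₁ (hs.trans hPu))
    SB9srcHP
  -- THE γ′ LEAF (dag-n05-w2: Lemma 1 kernel, Thm 2, Prop 3 := hP3, Thm 4; `p5e p5u p6 p7 t8` passed) at `ι := (·.1.1)`, source premiss ρ2, `LanF146`, zero source
  have leaf := b8LeafRSC_zdGF3HP₂_mapJ_γ' (𝔸 := θ.𝔸) (C₇ := 530 * (θ.D : ℝ) * (θ.L : ℝ) ^ 2) hD θ.two_le_L θ.L lam.β lam.len lam.inp hB₀β (le_of_eq hC₂eq) hcu hcP hγ' hB₈ hB₀8 hB8' hγB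
    (fun j : {j : IdxB8SubB θ // B8ConstraintBonds.DomainSeq θ.L j.1.1.Ω} => j.1.1.1)
    (fun (j : {j : IdxB8SubB θ // B8ConstraintBonds.DomainSeq θ.L j.1.1.Ω}) (f : Site θ.D → θ.𝔸) (U₀ : Site θ.D → Fin θ.D → θ.𝔸ˣ) (a0 b0 : ℝ) =>
      (InR138 θ.L j.1.1.1.k j.1.1.1.η (j.1.1.1.Ω 0) (j.1.1.1.Λs j.1.1.1.k) U₀ f ∧ (∀ x, IsSelfAdjoint (f x)) ∧ (∀ x, x ∉ j.1.1.1.Ω 0 → f x = 0) ∧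
          Bdd θ.L j.1.1.1.k j.1.1.1.η (-(2 : ℝ)) (fun jj (x : Site θ.D) => x ∈ j.1.1.1.Ω jj) f) ∧
        msup θ.L j.1.1.1.k j.1.1.1.η (-(2 : ℝ)) (fun jj (x : Site θ.D) => x ∈ j.1.1.1.Ω jj) f < γ₈ * (a0 + b0))
    (fun (j : {j : IdxB8SubB θ // B8ConstraintBonds.DomainSeq θ.L j.1.1.Ω}) (U₀ : Site θ.D → Fin θ.D → θ.𝔸ˣ) (f : Site θ.D → θ.𝔸) (m : ℕ) (W : Site θ.D → Fin θ.D → θ.𝔸ˣ) =>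
      LanF146 θ.L j.1.1.1.k j.1.1.1.η (j.1.1.1.Ω 0) j.1.1.1.Λs U₀ f m W)
    (fun j α₀ α₁ hα₀ hα₁ hs => Hb j.1.1.1.η j.1.1.1.k j.1.1.1.Ω j.1.1.1.Λs (fun m jj => towerBondsP θ.L j.1.1.1.Ω (j.1.1.1.Λs m) jj) j.1.1.1.hη j.1.1.1.hk j.1.1.1.hΩ
      (IdxB8SubB.tower_all j.1) (SLet j.1.1.1 j.1.1.2 j.1.2 j.2) α₀ α₁ hα₀ hα₁ (hs.trans hPb))
    (fun j α₀ α₁ hα₀ hα₁ hs => H5 j.1.1.1.η j.1.1.1.k j.1.1.1.Ω j.1.1.1.Λs (fun m jj => towerBondsP θ.L j.1.1.1.Ω (j.1.1.1.Λs m) jj) j.1.1.1.hη j.1.1.1.hΩ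
      (B8TowerBondsPrinted.ZdIdx.towerBondsP_laws j.1.1.1).1 (B8TowerBondsPrinted.ZdIdx.towerBondsP_laws j.1.1.1).2 (IdxB8SubB.tower_all j.1)
      j.1.2.trunc_lt j.1.2.trunc_top (SLet j.1.1.1 j.1.1.2 j.1.2 j.2) (SH59src j.1.1.1 j.1.1.2 j.1.2 j.2) α₀ α₁ hα₀ hα₁ (hs.trans hP5))
    (fun j α₀ α₁ hα₀ hα₁ hs => SH59src j.1.1.1 j.1.1.2 j.1.2 j.2 α₀ α₁ hα₀ hα₁ (hs.trans hP59))
    (fun j α₀ α₁ hα₀ hα₁ hs => Hu j.1.1.1.η j.1.1.1.k j.1.1.1.Ω j.1.1.1.Λs (fun m jj => towerBondsP θ.L j.1.1.1.Ω (j.1.1.1.Λs m) jj) j.1.1.1.hη j.1.1.1.hk j.1.1.1.hΩ j.1.1.2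
      (B8TowerBondsPrinted.ZdIdx.towerBondsP_laws j.1.1.1).1 (B8TowerBondsPrinted.ZdIdx.towerBondsP_laws j.1.1.1).2 j.1.1.1.htower
      (SLetUB j.1.1.1 j.1.1.2 j.1.2 j.2) (SH59src j.1.1.1 j.1.1.2 j.1.2 j.2) α₀ α₁ hα₀ hα₁ (hs.trans hPu))
    (0 : Site θ.D → θ.𝔸)
    (fun j α₀ α₁ hα₀ hα₁ U₀ _ =>
      ⟨⟨inR138_zero j.1.1.1.η θ.L U₀ j.1.1.1.k (j.1.1.1.Ω 0) (j.1.1.1.Λs j.1.1.1.k), fun _ => IsSelfAdjoint.zero θ.𝔸, fun _ _ => rfl,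
        bdd_of_forall (c := 0) fun _ _ _ _ => by simp⟩,
       lt_of_le_of_lt (msup_le le_rfl fun _ _ _ _ => by simp) (mul_pos hγ₈pos (add_pos hα₀ hα₁))⟩)
    (fun j U₀ W => lanF146_zero_iff θ.L j.1.1.1.k j.1.1.1.η (j.1.1.1.Ω 0) j.1.1.1.Λs U₀ j.1.1.1.k W)
    (fun j => j.1.1.2) (fun j => IdxB8SubB.tower_all j.1) hP3 (toAxial := fun j => toAxialTowerResid θ lam.β lam.len j.1.1) p5e p5u p6 p7 t8
  rw [hB₁']
  exact leaf

end KnitP2C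


end Summit.QuantumFields.YangMills.BalabanUVNodes.N05SubBP2CKnitGammaPrime

end
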